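import Mathlib
import Summits.ValiantsHypothesis.ValiantsHypothesis.Theses.ValuativeGCT
import Literature.Computability.AlgebraicComplexity.OrbitClosureWeights
import Summits.ValiantsHypothesis.ValiantsHypothesis.Theorems.ValuativeGCTCutBitesHwExtraction

/-!
# Block (Levi) embedding of `GL(K)` for a set `K` of row slots, and the left action on
functions of the `K`-rows (four-row bridge, part 1)

Infrastructure for stub `stub_fourRowBridge` of line `four-row-count` for crux
`ValuativeGCT.ValuativeFlip` (stmt-ValiantsHypothesis-12624).  `W = ℂ^{m×m}`,
`R = ℂ[End W] = MvPolynomial (MatIdx m × MatIdx m) ℂ` (variables `X (j, i)`, row slot `j`, matrix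
position `i`); the crux's Borel clause is semi-invariance under the LEFT translation
`X (j, i) ↦ ∑ l, B j l • X (l, i)` (`B = g⁻¹`).

For a decidable predicate `p` on the row slots (the kept slots `K = {p}`; in the bridge, the last
four slots) we use, WITHOUT introducing definitions (everything is written out):
* the block embedding `g ↦ reindex (sumCompl p) (sumCompl p) (fromBlocks g 0 0 1)` of
  `Matrix K K ℂ` into `Matrix (MatIdx m) (MatIdx m) ℂ` (identity on the complementary slots): entries,
  multiplicativity, unit, upper-triangularity, diagonal (`frb_blk_*`);
* the left action through it preserves the functions of the `K`-rows (`frb_leftAct_blk_mem_supported`),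
  and on such functions the left action of an upper triangular `g⁻¹` IS the action of its `K × K`
  block when `K` is an upper set (`frb_leftAct_inv_eq_leftAct_blk`), the block of the inverse being the
  inverse of the block (`frb_exists_projUnit`); weight characters factor accordingly
  (`frb_weightChar_eq_of_proj`, `frb_prod_blk_diag_zpow`).
Goodman–Wallach §3.2 (Levi subgroups of parabolics act on functions of a block of rows). [folklore]
-/

-- `Summit.ValiantsHypothesis.ValiantsHypothesis.…` is the tree's mandated single-conjunct layout (Sub = Summit).
set_option linter.dupNamespace false

namespace Summit.ValiantsHypothesis.ValiantsHypothesis.Theorems.ValuativeFlip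

open MvPolynomial
open scoped BigOperators Matrix
open Literature.NumberTheory.DiophantineGeometry
open Literature.Computability.AlgebraicComplexity
open Summit.ValiantsHypothesis.ValiantsHypothesis.Theorems.CutBitesAdjugate

noncomputable section

section Block

variable {m : ℕ} (p : MatIdx m → Prop) [DecidablePred p]

/-! ### Entries of the block embedding -/

/-- Block embedding, kept/kept entry. [folklore] -/
theorem frb_blk_apply_pos_pos (g : Matrix {a // p a} {a // p a} ℂ) {a b : MatIdx m} (ha : p a) (hb : p b) :
    Matrix.reindex (Equiv.sumCompl p) (Equiv.sumCompl p)
        (Matrix.fromBlocks g 0 0 (1 : Matrix {a // ¬ p a} {a // ¬ p a} ℂ)) a b = g ⟨a, ha⟩ ⟨b, hb⟩ := by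
  rw [Matrix.reindex_apply, Matrix.submatrix_apply, Equiv.sumCompl_symm_apply_of_pos ha,
    Equiv.sumCompl_symm_apply_of_pos hb, Matrix.fromBlocks_apply₁₁]

/-- Block embedding, kept/non-kept entry. [folklore] -/
theorem frb_blk_apply_pos_neg (g : Matrix {a // p a} {a // p a} ℂ) {a b : MatIdx m} (ha : p a) (hb : ¬ p b) :
    Matrix.reindex (Equiv.sumCompl p) (Equiv.sumCompl p)
        (Matrix.fromBlocks g 0 0 (1 : Matrix {a // ¬ p a} {a // ¬ p a} ℂ)) a b = 0 := by
  rw [Matrix.reindex_apply, Matrix.submatrix_apply, Equiv.sumCompl_symm_apply_of_pos ha,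
    Equiv.sumCompl_symm_apply_of_neg hb, Matrix.fromBlocks_apply₁₂, Matrix.zero_apply]

/-- Block embedding, non-kept/kept entry. [folklore] -/
theorem frb_blk_apply_neg_pos (g : Matrix {a // p a} {a // p a} ℂ) {a b : MatIdx m} (ha : ¬ p a) (hb : p b) :
    Matrix.reindex (Equiv.sumCompl p) (Equiv.sumCompl p)
        (Matrix.fromBlocks g 0 0 (1 : Matrix {a // ¬ p a} {a // ¬ p a} ℂ)) a b = 0 := by
  rw [Matrix.reindex_apply, Matrix.submatrix_apply, Equiv.sumCompl_symm_apply_of_neg ha,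
    Equiv.sumCompl_symm_apply_of_pos hb, Matrix.fromBlocks_apply₂₁, Matrix.zero_apply]

/-- Block embedding, non-kept/non-kept entry (the identity block). [folklore] -/
theorem frb_blk_apply_neg_neg (g : Matrix {a // p a} {a // p a} ℂ) {a b : MatIdx m} (ha : ¬ p a) (hb : ¬ p b) :
    Matrix.reindex (Equiv.sumCompl p) (Equiv.sumCompl p)
        (Matrix.fromBlocks g 0 0 (1 : Matrix {a // ¬ p a} {a // ¬ p a} ℂ)) a b = if a = b then 1 else 0 := by
  rw [Matrix.reindex_apply, Matrix.submatrix_apply, Equiv.sumCompl_symm_apply_of_neg ha,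
    Equiv.sumCompl_symm_apply_of_neg hb, Matrix.fromBlocks_apply₂₂, Matrix.one_apply]
  by_cases hab : a = b
  · subst hab
    simp
  · rw [if_neg hab, if_neg fun h => hab (congrArg Subtype.val h)]

/-- Column `b` of the block embedding is the unit vector `e_b` when `b` is not kept. [folklore] -/
theorem frb_blk_apply_of_neg_right (g : Matrix {a // p a} {a // p a} ℂ) (a : MatIdx m) {b : MatIdx m} (hb : ¬ p b) :
    Matrix.reindex (Equiv.sumCompl p) (Equiv.sumCompl p)
        (Matrix.fromBlocks g 0 0 (1 : Matrix {a // ¬ p a} {a // ¬ p a} ℂ)) a b = if a = b then 1 else 0 := by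
  by_cases ha : p a
  · rw [frb_blk_apply_pos_neg p g ha hb, if_neg]
    rintro rfl
    exact hb ha
  · exact frb_blk_apply_neg_neg p g ha hb

/-- The diagonal of the block embedding. [folklore] -/
theorem frb_blk_diag (g : Matrix {a // p a} {a // p a} ℂ) (a : MatIdx m) :
    Matrix.reindex (Equiv.sumCompl p) (Equiv.sumCompl p)
        (Matrix.fromBlocks g 0 0 (1 : Matrix {a // ¬ p a} {a // ¬ p a} ℂ)) a a =
      if h : p a then g ⟨a, h⟩ ⟨a, h⟩ else 1 := by
  by_cases ha : p a
  · rw [frb_blk_apply_pos_pos p g ha ha, dif_pos ha]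
  · rw [frb_blk_apply_neg_neg p g ha ha, if_pos rfl, dif_neg ha]

/-! ### The block embedding is a monoid homomorphism preserving upper-triangularity -/

/-- Multiplicativity of the block embedding. [folklore] -/
theorem frb_blk_mul (g h : Matrix {a // p a} {a // p a} ℂ) :
    Matrix.reindex (Equiv.sumCompl p) (Equiv.sumCompl p)
        (Matrix.fromBlocks (g * h) 0 0 (1 : Matrix {a // ¬ p a} {a // ¬ p a} ℂ)) =
      Matrix.reindex (Equiv.sumCompl p) (Equiv.sumCompl p)
          (Matrix.fromBlocks g 0 0 (1 : Matrix {a // ¬ p a} {a // ¬ p a} ℂ)) *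
        Matrix.reindex (Equiv.sumCompl p) (Equiv.sumCompl p)
          (Matrix.fromBlocks h 0 0 (1 : Matrix {a // ¬ p a} {a // ¬ p a} ℂ)) := by
  rw [Matrix.reindex_apply, Matrix.reindex_apply, Matrix.reindex_apply, Matrix.submatrix_mul_equiv,
    Matrix.fromBlocks_multiply]
  simp

/-- The block embedding of the identity is the identity. [folklore] -/
theorem frb_blk_one :
    Matrix.reindex (Equiv.sumCompl p) (Equiv.sumCompl p)
        (Matrix.fromBlocks (1 : Matrix {a // p a} {a // p a} ℂ) 0 0 (1 : Matrix {a // ¬ p a} {a // ¬ p a} ℂ)) = 1 := by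
  rw [Matrix.fromBlocks_one, Matrix.reindex_apply, Matrix.submatrix_one_equiv]

/-- The block embedding of an upper triangular matrix is upper triangular (for the ambient linear
order and the induced order on the kept slots). [folklore] -/
theorem frb_blk_blockTriangular {g : Matrix {a // p a} {a // p a} ℂ} (hg : g.BlockTriangular id) :
    (Matrix.reindex (Equiv.sumCompl p) (Equiv.sumCompl p)
        (Matrix.fromBlocks g 0 0 (1 : Matrix {a // ¬ p a} {a // ¬ p a} ℂ))).BlockTriangular id := by
  intro a b hba
  by_cases ha : p a <;> by_cases hb : p b
  · rw [frb_blk_apply_pos_pos p g ha hb]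
    exact hg hba
  · exact frb_blk_apply_pos_neg p g ha hb
  · exact frb_blk_apply_neg_pos p g ha hb
  · rw [frb_blk_apply_neg_neg p g ha hb, if_neg]
    exact ne_of_gt hba

/-- The diagonal character of the block embedding: `∏_a blk(g)_{aa}^{χ̃ a} = ∏_{a ∈ K} g_{aa}^{χ₄ a}` for the
extension `χ̃` by zero of a weight `χ₄` of the kept slots. [folklore] -/
theorem frb_prod_blk_diag_zpow (g : Matrix {a // p a} {a // p a} ℂ) (χ₄ : Weight {a // p a}) :
    ∏ a : MatIdx m, Matrix.reindex (Equiv.sumCompl p) (Equiv.sumCompl p)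
        (Matrix.fromBlocks g 0 0 (1 : Matrix {a // ¬ p a} {a // ¬ p a} ℂ)) a a ^
          (fun a : MatIdx m => if h : p a then χ₄ ⟨a, h⟩ else 0) a =
      ∏ a : {a // p a}, g a a ^ χ₄ a := by
  rw [← Fintype.prod_subtype_mul_prod_subtype p]
  have h2 : ∏ a : {a // ¬ p a}, Matrix.reindex (Equiv.sumCompl p) (Equiv.sumCompl p)
        (Matrix.fromBlocks g 0 0 (1 : Matrix {a // ¬ p a} {a // ¬ p a} ℂ)) a a ^
          (fun a : MatIdx m => if h : p a then χ₄ ⟨a, h⟩ else 0) a = 1 :=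
    Finset.prod_eq_one fun a _ => by simp only [dif_neg a.2, zpow_zero]
  rw [h2, mul_one]
  refine Finset.prod_congr rfl fun a _ => ?_
  simp only [dif_pos a.2, frb_blk_apply_pos_pos p g a.2 a.2]

/-- Weight characters along a matrix whose kept diagonal block is given: if `g₄` has the same kept
diagonal entries as `g`, then `weightChar χ̃ g = weightChar χ₄ g₄` for the extension `χ̃` by zero. [folklore] -/
theorem frb_weightChar_eq_of_proj (χ₄ : Weight {a // p a}) (g : GL (MatIdx m) ℂ) (g₄ : GL {a // p a} ℂ)
    (h : ∀ a : {a // p a}, (g₄ : Matrix {a // p a} {a // p a} ℂ) a a = (g : Matrix (MatIdx m) (MatIdx m) ℂ) a a) :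
    weightChar (fun a : MatIdx m => if h : p a then χ₄ ⟨a, h⟩ else 0) g = weightChar χ₄ g₄ := by
  unfold weightChar
  rw [← Fintype.prod_subtype_mul_prod_subtype p]
  have h2 : ∏ a : {a // ¬ p a}, (g : Matrix (MatIdx m) (MatIdx m) ℂ) a a ^
        (fun a : MatIdx m => if h : p a then χ₄ ⟨a, h⟩ else 0) a = 1 :=
    Finset.prod_eq_one fun a _ => by simp only [dif_neg a.2, zpow_zero]
  rw [h2, mul_one]
  refine Finset.prod_congr rfl fun a _ => ?_
  simp only [dif_pos a.2, h a]

/-! ### The left action on functions of the kept rows -/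

omit [DecidablePred p] in
/-- Two left actions that agree on the kept rows agree on functions of the kept rows. [folklore] -/
theorem frb_leftAct_congr {B B' : Matrix (MatIdx m) (MatIdx m) ℂ} {G : MvPolynomial (MatIdx m × MatIdx m) ℂ}
    (hG : G ∈ MvPolynomial.supported ℂ {q : MatIdx m × MatIdx m | p q.1})
    (h : ∀ j, p j → ∀ l, B j l = B' j l) :
    MvPolynomial.aeval (R := ℂ) (fun q : MatIdx m × MatIdx m =>
        ∑ l : MatIdx m, B q.1 l • (X (l, q.2) : MvPolynomial (MatIdx m × MatIdx m) ℂ)) G =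
      MvPolynomial.aeval (R := ℂ) (fun q : MatIdx m × MatIdx m =>
        ∑ l : MatIdx m, B' q.1 l • (X (l, q.2) : MvPolynomial (MatIdx m × MatIdx m) ℂ)) G := by
  have hvars : (↑G.vars : Set (MatIdx m × MatIdx m)) ⊆ {q : MatIdx m × MatIdx m | p q.1} := mem_supported.mp hG
  refine MvPolynomial.hom_congr_vars
    (f₁ := (MvPolynomial.aeval (R := ℂ) (fun q : MatIdx m × MatIdx m =>
        ∑ l : MatIdx m, B q.1 l • (X (l, q.2) : MvPolynomial (MatIdx m × MatIdx m) ℂ))).toRingHom)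
    (f₂ := (MvPolynomial.aeval (R := ℂ) (fun q : MatIdx m × MatIdx m =>
        ∑ l : MatIdx m, B' q.1 l • (X (l, q.2) : MvPolynomial (MatIdx m × MatIdx m) ℂ))).toRingHom)
    ?_ ?_ rfl
  · ext c
    simp
  · intro q hq _
    have hpq : p q.1 := hvars (Finset.mem_coe.mpr hq)
    simp only [AlgHom.toRingHom_eq_coe, RingHom.coe_coe, aeval_X]
    exact Finset.sum_congr rfl fun l _ => by rw [h q.1 hpq l]

omit [DecidablePred p] in
/-- An algebra map sending the kept-row variables into a subalgebra sends every function of the kept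
rows into it. [folklore] -/
theorem frb_aeval_mem_of_supported {S : Subalgebra ℂ (MvPolynomial (MatIdx m × MatIdx m) ℂ)}
    (f : MatIdx m × MatIdx m → MvPolynomial (MatIdx m × MatIdx m) ℂ)
    (hf : ∀ q : MatIdx m × MatIdx m, p q.1 → f q ∈ S)
    {G : MvPolynomial (MatIdx m × MatIdx m) ℂ}
    (hG : G ∈ MvPolynomial.supported ℂ {q : MatIdx m × MatIdx m | p q.1}) :
    MvPolynomial.aeval f G ∈ S := by
  rw [supported_eq_range_rename, AlgHom.mem_range] at hG
  obtain ⟨G₀, rfl⟩ := hG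
  change MvPolynomial.aeval f (rename (Subtype.val : {q : MatIdx m × MatIdx m // p q.1} → MatIdx m × MatIdx m) G₀) ∈ S
  rw [aeval_rename]
  have hrange : (MvPolynomial.aeval (R := ℂ)
      (f ∘ (Subtype.val : {q : MatIdx m × MatIdx m // p q.1} → MatIdx m × MatIdx m))).range ≤ S := by
    rw [aeval_range, Algebra.adjoin_le_iff]
    rintro _ ⟨q, rfl⟩
    exact hf q.1 q.2
  exact hrange ⟨G₀, rfl⟩

/-- The left action through the block embedding preserves the functions of the kept rows. [folklore] -/
theorem frb_leftAct_blk_mem_supported (g : Matrix {a // p a} {a // p a} ℂ)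
    {G : MvPolynomial (MatIdx m × MatIdx m) ℂ}
    (hG : G ∈ MvPolynomial.supported ℂ {q : MatIdx m × MatIdx m | p q.1}) :
    MvPolynomial.aeval (R := ℂ) (fun q : MatIdx m × MatIdx m =>
        ∑ l : MatIdx m, Matrix.reindex (Equiv.sumCompl p) (Equiv.sumCompl p)
          (Matrix.fromBlocks g 0 0 (1 : Matrix {a // ¬ p a} {a // ¬ p a} ℂ)) q.1 l •
            (X (l, q.2) : MvPolynomial (MatIdx m × MatIdx m) ℂ)) G ∈
      MvPolynomial.supported ℂ {q : MatIdx m × MatIdx m | p q.1} := by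
  refine frb_aeval_mem_of_supported p _ (fun q hq => ?_) hG
  refine Subalgebra.sum_mem _ fun l _ => ?_
  by_cases hl : p l
  · refine Subalgebra.smul_mem _ ?_ _
    exact (MvPolynomial.X_mem_supported (R := ℂ) (s := {q : MatIdx m × MatIdx m | p q.1}) (i := (l, q.2))).mpr hl
  · rw [frb_blk_apply_pos_neg p g hq hl, zero_smul]
    exact Subalgebra.zero_mem _

/-! ### Upper triangular matrices and the kept block (kept slots an upper set) -/

omit [DecidablePred p] in
/-- For an upper set `K` of slots, an upper triangular matrix has zero block `K × Kᶜ`. [folklore] -/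
theorem frb_apply_eq_zero_of_isUpperTriangular (hp : ∀ a b : MatIdx m, a ≤ b → p a → p b)
    {g : GL (MatIdx m) ℂ} (hg : IsUpperTriangular g) {j l : MatIdx m} (hj : p j) (hl : ¬ p l) :
    (g : Matrix (MatIdx m) (MatIdx m) ℂ) j l = 0 :=
  hg.apply_eq_zero (lt_of_not_ge fun hjl => hl (hp j l hjl hj))

/-- The kept block of a product `M N` is the product of the kept blocks when `M` has zero block
`K × Kᶜ`. [folklore] -/
theorem frb_proj_mul {M : Matrix (MatIdx m) (MatIdx m) ℂ} (N : Matrix (MatIdx m) (MatIdx m) ℂ)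
    (hM : ∀ j l, p j → ¬ p l → M j l = 0) :
    (M * N).submatrix (Subtype.val : {a // p a} → MatIdx m) (Subtype.val : {a // p a} → MatIdx m) =
      M.submatrix (Subtype.val : {a // p a} → MatIdx m) (Subtype.val : {a // p a} → MatIdx m) *
        N.submatrix (Subtype.val : {a // p a} → MatIdx m) (Subtype.val : {a // p a} → MatIdx m) := by
  ext a b
  simp only [Matrix.submatrix_apply, Matrix.mul_apply]
  rw [← Fintype.sum_subtype_add_sum_subtype p (fun l : MatIdx m => M a.1 l * N l b.1)]
  have h0 : ∑ l : {a // ¬ p a}, M a.1 l * N l b.1 = 0 :=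
    Finset.sum_eq_zero fun l _ => by rw [hM a.1 l.1 a.2 l.2, zero_mul]
  rw [h0, add_zero]

/-- **The kept block of an upper triangular invertible matrix is invertible, with inverse the kept block of
the inverse**, and it is upper triangular (kept slots an upper set). [folklore] -/
theorem frb_exists_projUnit (hp : ∀ a b : MatIdx m, a ≤ b → p a → p b)
    {g : GL (MatIdx m) ℂ} (hg : IsUpperTriangular g) :
    ∃ g₄ : GL {a // p a} ℂ,
      (g₄ : Matrix {a // p a} {a // p a} ℂ) =
        (g : Matrix (MatIdx m) (MatIdx m) ℂ).submatrix (Subtype.val : {a // p a} → MatIdx m) (Subtype.val : {a // p a} → MatIdx m) ∧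
      ((g₄⁻¹ : GL {a // p a} ℂ) : Matrix {a // p a} {a // p a} ℂ) =
        ((g⁻¹ : GL (MatIdx m) ℂ) : Matrix (MatIdx m) (MatIdx m) ℂ).submatrix
          (Subtype.val : {a // p a} → MatIdx m) (Subtype.val : {a // p a} → MatIdx m) ∧
      IsUpperTriangular g₄ := by
  have hg' : IsUpperTriangular g⁻¹ := (borelSubgroup (MatIdx m) ℂ).inv_mem hg
  have hM : ∀ j l, p j → ¬ p l → (g : Matrix (MatIdx m) (MatIdx m) ℂ) j l = 0 :=
    fun j l hj hl => frb_apply_eq_zero_of_isUpperTriangular p hp hg hj hl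
  have hM' : ∀ j l, p j → ¬ p l → ((g⁻¹ : GL (MatIdx m) ℂ) : Matrix (MatIdx m) (MatIdx m) ℂ) j l = 0 :=
    fun j l hj hl => frb_apply_eq_zero_of_isUpperTriangular p hp hg' hj hl
  have h1 : (g : Matrix (MatIdx m) (MatIdx m) ℂ).submatrix (Subtype.val : {a // p a} → MatIdx m) (Subtype.val : {a // p a} → MatIdx m) *
      ((g⁻¹ : GL (MatIdx m) ℂ) : Matrix (MatIdx m) (MatIdx m) ℂ).submatrix
        (Subtype.val : {a // p a} → MatIdx m) (Subtype.val : {a // p a} → MatIdx m) = 1 := by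
    rw [← frb_proj_mul p _ hM, ← Units.val_mul, mul_inv_cancel, Units.val_one,
      Matrix.submatrix_one _ Subtype.val_injective]
  have h2 : ((g⁻¹ : GL (MatIdx m) ℂ) : Matrix (MatIdx m) (MatIdx m) ℂ).submatrix
        (Subtype.val : {a // p a} → MatIdx m) (Subtype.val : {a // p a} → MatIdx m) *
      (g : Matrix (MatIdx m) (MatIdx m) ℂ).submatrix (Subtype.val : {a // p a} → MatIdx m) (Subtype.val : {a // p a} → MatIdx m) = 1 := by
    rw [← frb_proj_mul p _ hM', ← Units.val_mul, inv_mul_cancel, Units.val_one,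
      Matrix.submatrix_one _ Subtype.val_injective]
  refine ⟨⟨_, _, h1, h2⟩, rfl, rfl, ?_⟩
  intro a b hba
  exact hg.apply_eq_zero hba

/-- **On functions of the kept rows, the left action of an upper triangular `g⁻¹` is the left action of
the block embedding of its kept block** (kept slots an upper set: the `K × Kᶜ` block of `g⁻¹` vanishes).
[folklore] -/
theorem frb_leftAct_inv_eq_leftAct_blk (hp : ∀ a b : MatIdx m, a ≤ b → p a → p b)
    {g : GL (MatIdx m) ℂ} (hg : IsUpperTriangular g)
    {G : MvPolynomial (MatIdx m × MatIdx m) ℂ}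
    (hG : G ∈ MvPolynomial.supported ℂ {q : MatIdx m × MatIdx m | p q.1}) :
    MvPolynomial.aeval (R := ℂ) (fun q : MatIdx m × MatIdx m =>
        ∑ l : MatIdx m, ((g⁻¹ : GL (MatIdx m) ℂ) : Matrix (MatIdx m) (MatIdx m) ℂ) q.1 l •
          (X (l, q.2) : MvPolynomial (MatIdx m × MatIdx m) ℂ)) G =
      MvPolynomial.aeval (R := ℂ) (fun q : MatIdx m × MatIdx m =>
        ∑ l : MatIdx m, Matrix.reindex (Equiv.sumCompl p) (Equiv.sumCompl p)
          (Matrix.fromBlocks (((g⁻¹ : GL (MatIdx m) ℂ) : Matrix (MatIdx m) (MatIdx m) ℂ).submatrix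
            (Subtype.val : {a // p a} → MatIdx m) (Subtype.val : {a // p a} → MatIdx m)) 0 0
            (1 : Matrix {a // ¬ p a} {a // ¬ p a} ℂ)) q.1 l •
            (X (l, q.2) : MvPolynomial (MatIdx m × MatIdx m) ℂ)) G := by
  have hg' : IsUpperTriangular g⁻¹ := (borelSubgroup (MatIdx m) ℂ).inv_mem hg
  refine frb_leftAct_congr p hG fun j hj l => ?_
  by_cases hl : p l
  · rw [frb_blk_apply_pos_pos p _ hj hl]
    rfl
  · rw [frb_blk_apply_pos_neg p _ hj hl]
    exact frb_apply_eq_zero_of_isUpperTriangular p hp hg' hj hl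

/-! ### Borel semi-invariance: full Borel versus the Borel of the kept block -/

/-- **From the kept block to the full Borel.**  A function of the kept rows (kept slots an upper set)
that is a semi-invariant of weight `χ₄` for the upper triangular matrices of `GL(K)` acting through the
block embedding is a semi-invariant of weight `χ̃` (extension by zero) for the full upper triangular
Borel subgroup acting by left translation `G ↦ G(g⁻¹ ·)`. [folklore; Goodman–Wallach §3.2] -/
theorem frb_borel_of_blockBorel (hp : ∀ a b : MatIdx m, a ≤ b → p a → p b) (χ₄ : Weight {a // p a})
    {G : MvPolynomial (MatIdx m × MatIdx m) ℂ}
    (hG : G ∈ MvPolynomial.supported ℂ {q : MatIdx m × MatIdx m | p q.1})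
    (h : ∀ b : GL {a // p a} ℂ, IsUpperTriangular b →
      MvPolynomial.aeval (R := ℂ) (fun q : MatIdx m × MatIdx m =>
        ∑ l : MatIdx m, Matrix.reindex (Equiv.sumCompl p) (Equiv.sumCompl p)
          (Matrix.fromBlocks ((b⁻¹ : GL {a // p a} ℂ) : Matrix {a // p a} {a // p a} ℂ) 0 0
            (1 : Matrix {a // ¬ p a} {a // ¬ p a} ℂ)) q.1 l •
            (X (l, q.2) : MvPolynomial (MatIdx m × MatIdx m) ℂ)) G = weightChar χ₄ b • G) :
    ∀ g : GL (MatIdx m) ℂ, IsUpperTriangular g →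
      MvPolynomial.aeval (R := ℂ) (fun q : MatIdx m × MatIdx m =>
        ∑ l : MatIdx m, ((g⁻¹ : GL (MatIdx m) ℂ) : Matrix (MatIdx m) (MatIdx m) ℂ) q.1 l •
          (X (l, q.2) : MvPolynomial (MatIdx m × MatIdx m) ℂ)) G =
        weightChar (fun a : MatIdx m => if h : p a then χ₄ ⟨a, h⟩ else 0) g • G := by
  intro g hg
  obtain ⟨g₄, h1, h2, h3⟩ := frb_exists_projUnit p hp hg
  rw [frb_leftAct_inv_eq_leftAct_blk p hp hg hG, ← h2, h g₄ h3,
    frb_weightChar_eq_of_proj p χ₄ g g₄ fun a => by rw [h1]; rfl]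

/-- **From the full Borel to the kept block.**  A semi-invariant of weight `χ̃` (extension by zero of
`χ₄`) for the full upper triangular Borel subgroup (left translation) is a semi-invariant of weight `χ₄`
for the upper triangular matrices of `GL(K)` acting through the block embedding (which is an upper
triangular element of `GL(W)` with the same kept diagonal). [folklore; Goodman–Wallach §3.2] -/
theorem frb_blockBorel_of_borel (χ₄ : Weight {a // p a})
    {G : MvPolynomial (MatIdx m × MatIdx m) ℂ}
    (h : ∀ g : GL (MatIdx m) ℂ, IsUpperTriangular g →
      MvPolynomial.aeval (R := ℂ) (fun q : MatIdx m × MatIdx m =>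
        ∑ l : MatIdx m, ((g⁻¹ : GL (MatIdx m) ℂ) : Matrix (MatIdx m) (MatIdx m) ℂ) q.1 l •
          (X (l, q.2) : MvPolynomial (MatIdx m × MatIdx m) ℂ)) G =
        weightChar (fun a : MatIdx m => if h : p a then χ₄ ⟨a, h⟩ else 0) g • G)
    (b : GL {a // p a} ℂ) (hb : IsUpperTriangular b) :
    MvPolynomial.aeval (R := ℂ) (fun q : MatIdx m × MatIdx m =>
        ∑ l : MatIdx m, Matrix.reindex (Equiv.sumCompl p) (Equiv.sumCompl p)
          (Matrix.fromBlocks ((b⁻¹ : GL {a // p a} ℂ) : Matrix {a // p a} {a // p a} ℂ) 0 0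
            (1 : Matrix {a // ¬ p a} {a // ¬ p a} ℂ)) q.1 l •
            (X (l, q.2) : MvPolynomial (MatIdx m × MatIdx m) ℂ)) G = weightChar χ₄ b • G := by
  let φ : Matrix {a // p a} {a // p a} ℂ →* Matrix (MatIdx m) (MatIdx m) ℂ :=
    { toFun := fun g => Matrix.reindex (Equiv.sumCompl p) (Equiv.sumCompl p)
        (Matrix.fromBlocks g 0 0 (1 : Matrix {a // ¬ p a} {a // ¬ p a} ℂ))
      map_one' := frb_blk_one p
      map_mul' := frb_blk_mul p }
  have hφ : ∀ g : Matrix {a // p a} {a // p a} ℂ, φ g = Matrix.reindex (Equiv.sumCompl p) (Equiv.sumCompl p)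
      (Matrix.fromBlocks g 0 0 (1 : Matrix {a // ¬ p a} {a // ¬ p a} ℂ)) := fun _ => rfl
  have hU : IsUpperTriangular (Units.map φ b) := by
    change ((Units.map φ b : GL (MatIdx m) ℂ) : Matrix (MatIdx m) (MatIdx m) ℂ).BlockTriangular id
    rw [Units.coe_map, hφ]
    exact frb_blk_blockTriangular p hb
  have h1 := h (Units.map φ b) hU
  rw [Units.coe_map_inv, hφ] at h1
  rw [h1, frb_weightChar_eq_of_proj p χ₄ (Units.map φ b) b fun a => ?_]
  rw [Units.coe_map, hφ, frb_blk_apply_pos_pos p _ a.2 a.2]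

end Block

/-- **Block-Borel transfer for functions of an upper set of rows** (registered sub-goal of
`stub_fourRowBridge`, line four-row-count).  For an upper set `K = {p}` of row slots, a function of the
`K`-rows that is a semi-invariant of weight `χ₄` for the upper triangular matrices of `GL(K)` acting by
left translation through the block embedding `GL(K) → GL(W)` is a semi-invariant, of the weight extended
by zero, for the full upper triangular Borel subgroup of `GL(W)` acting by `G ↦ G(g⁻¹ ·)` — the crux's
Borel clause.  (The per-side highest-weight vectors of the `GL₄`-count are crux highest-weight vectors.)
[folklore; Goodman–Wallach §3.2] -/
theorem fourRow_borel_of_blockBorel {m : ℕ} (p : MatIdx m → Prop) [DecidablePred p]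
    (hp : ∀ a b : MatIdx m, a ≤ b → p a → p b) (χ₄ : Weight {a // p a})
    {G : MvPolynomial (MatIdx m × MatIdx m) ℂ}
    (hG : G ∈ MvPolynomial.supported ℂ {q : MatIdx m × MatIdx m | p q.1})
    (h : ∀ b : GL {a // p a} ℂ, IsUpperTriangular b →
      MvPolynomial.aeval (R := ℂ) (fun q : MatIdx m × MatIdx m =>
        ∑ l : MatIdx m, Matrix.reindex (Equiv.sumCompl p) (Equiv.sumCompl p)
          (Matrix.fromBlocks ((b⁻¹ : GL {a // p a} ℂ) : Matrix {a // p a} {a // p a} ℂ) 0 0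
            (1 : Matrix {a // ¬ p a} {a // ¬ p a} ℂ)) q.1 l •
            (X (l, q.2) : MvPolynomial (MatIdx m × MatIdx m) ℂ)) G = weightChar χ₄ b • G) :
    ∀ g : GL (MatIdx m) ℂ, IsUpperTriangular g →
      MvPolynomial.aeval (R := ℂ) (fun q : MatIdx m × MatIdx m =>
        ∑ l : MatIdx m, ((g⁻¹ : GL (MatIdx m) ℂ) : Matrix (MatIdx m) (MatIdx m) ℂ) q.1 l •
          (X (l, q.2) : MvPolynomial (MatIdx m × MatIdx m) ℂ)) G =
        weightChar (fun a : MatIdx m => if h : p a then χ₄ ⟨a, h⟩ else 0) g • G :=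
  frb_borel_of_blockBorel p hp χ₄ hG h

end

end Summit.ValiantsHypothesis.ValiantsHypothesis.Theorems.ValuativeFlip
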